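import Mathlib
import Literature.MathematicalPhysics.QuantumFieldTheory.Balaban1983to89.B6LevelGapMetric
import Literature.MathematicalPhysics.QuantumFieldTheory.Balaban1983to89.B15PrelimIntegrations

/-!
# `Balaban1983to89.B15Ineq147LevelGap` — [Balaban1989LargeFieldI] (1.47) p. 186: the GEOMETRIC INPUT
# «d(y, Ω^c_{j+1}∖Z″_{j+1}) ≥ (M/M₁)(j − i) for y ∈ Γ″_i, i < j», *"by the definition of the domains Z″_i"*, DERIVED as the
# level-gap mechanism of [3] = [Balaban1984PropagatorsII] (2.46)–(2.48)/(2.57)/(2.60) for the admissible sequence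
# Ω″_n = (Z″_n)^c of p. 179 (walk form, no connectedness hypothesis), + a concrete ℤᵈ cube model

statement-level skeleton of published theorems with citation tags; proofs where landed; nothing here is a claim about
the Yang–Mills mass gap.

CITATION HEADER (lean-in-tree rule 2026-08-18).  T. Bałaban, *Large field renormalization. I. The basic step of the 𝐑
operation*, Commun. Math. Phys. **122**, 175–202 (1989), doi:10.1007/BF01257412, bib `Balaban1989LargeFieldI` (cell paper
B15 = [IV]; PDF held `paper:balaban1989-cmp122-large-field-i`; p. 179 = PDF 5, p. 186 = PDF 12, OCR `p0005.txt`, `p0012.txt`).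
"[3]" of [15] = T. Bałaban, *Propagators and renormalization transformations for lattice gauge theories. II*, Commun. Math.
Phys. **96**, 223–250 (1984), doi:10.1007/bf01240221, bib `Balaban1984PropagatorsII` (cell paper B6; pp. 224, 231–234).
WHAT IS REPRODUCED: SKELETON row `B15.Eq1.47` (owner r12; typed p239014 `B15.PrelimIntegrations.Ineq147` with the
monotonicity step `ineq147_of_dist` proved and the geometric input carried as the hypothesis `hgeo`/`hD` of r12's
`B15Ineq148From190.ineq148_lattice_of_ineq190_gamma`), unit `lit-balaban-p29` gen 8 (Phase-2 free target, G.5-34(d)), HOME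
`run/shared/lean/pub/lit-balaban/`.  KNITTING — used BY NAME, nothing restated: `B6Geometry.LevelGap`, `Separates`,
`separates_of_levelGap`, `ContourSystem`, `Realizes`, `dist246` (pv08 g2), `B6LevelGapMetric.BondScale`, `ZoneSep`, `SetSep`,
`ZonesOf`, `levelGap_of_metric`, `setSep_iff_zoneSep` (pv08 g3), `B15.PrelimIntegrations.Ineq147`, `ineq147_of_dist` (r12).

THE PRINTED TEXT.  p. 186 [PDF 12], verbatim: *"Here d(·,·) is the scaled distance, y is a point of the ith component of
the determining set 𝔹_k^{(n)}. … for p ∈ B^i(y), where y ∈ (Z″_{i+1}∖Z″_i)^{(i)} = Γ″_i for i = j − 1, j − 2, …, and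
y ∈ (Ω^c_{j+1}∖Z″_j)^{(j)} for i = j. (1.46)  Let us remark that the scaled distance in the above estimates is defined in
terms of M₁-cubes on corresponding scales. Thus, by the definition of the domains Z″_i, we obtain
exp(−δd(y, Ω^c_{j+1}∖Z″_{j+1})) ≦ exp(−δ(M/M₁)(j − i)) for y ∈ Γ″_i, i < j. (1.47)  We choose M large enough, so that
δ(M/M₁) ≧ 2."*  p. 179 [PDF 5], the definition referred to: *"Let us recall that the domains Ω″_j are unions of
L^{−(k−j)}MR_j cubes of the lattice T_η. … complete these two sets to a sequence Z″_k, Z″_{k−1}, …, Z″_{k−N₀+2}, Z″_{k−N₀+1}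
in such a way that the complements of these sets form an admissible sequence of domains based on partitions into M-cubes
in the corresponding scales. Thus Z″_k, Z″_k∖Z″_{k−1} are unions of M-cubes of the lattice T_η, and Z″_k, Z″_{k−1} are
separated by one layer of M-cubes. Similarly, Z″_{k−1}, Z″_{k−1}∖Z″_{k−2} are unions of L^{−1}M-cubes of this lattice, and
Z″_{k−1}, Z″_{k−2} are separated by one layer of L^{−1}M-cubes, and so on."*  [3] p. 231 (2.46): *"d(y, y′) =
inf_{Γ_{y,y′}} Σ_{j=0}^k (L^jη)^{−1}|Γ_{y,y′} ∩ B^j(Λ_j)|"* over admissible contours; p. 224 (2.2) *"(L^jη)^{−1} dist(Ω_j^c,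
Ω_{j+1}) > RM"*; p. 233 (2.57); p. 234 (2.60) *"e^{−αδ₀d(y,y′)} ≤ e^{−αδ₀RM max{|j−j′|−1,0}}, y ∈ Λ_j, y′ ∈ Λ_{j′}"*.

THE DICTIONARY (ours; cf. `B6Geometry`/`B6LevelGapMetric` module docstrings).  The admissible sequence of p. 179 is, inside
the large field region Z where the determining sets 𝔹_k^{(n)}(Z) of (1.19)–(1.20) and their fields live ((1.12):
Ω″_j = (Z″_j^c ∩ Z) ∪ (Ω_j ∩ Z^c), so Ω″_j ∩ Z = (Z″_j)^c ∩ Z), the sequence of complements Ω″_n := (Z″_n)^c (decreasing in n,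
since Z″_n ⊂ Z″_{n+1}; all statements below quantify over the sites of ONE contour system, to be read as that of the
Z-localised problem); its layers are Λ″_n = Ω″_n∖Ω″_{n+1} = Z″_{n+1}∖Z″_n, whose
scale-n lattice points are Γ″_n (p. 186); so in the zoned graph of admissible contours a point of Γ″_n has ZONE n, a point
of Z″_n has zone < n, and a point of (Z″_{j+1})^c ⊇ Ω^c_{j+1}∖Z″_{j+1} has zone ≥ j + 1 (`ZonesOfZ`).  *"The scaled distance
… is defined in terms of M₁-cubes on corresponding scales"*: an admissible bond of zone n is a step between neighbouring
M₁Lⁿη-cubes, of T_η-length ≤ ℓ n := M₁·Lⁿ·η (`BondScale`).  *"Z″_{n+1}, Z″_n are separated by one layer of [ML^{n+1}η]-cubes"*: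
dist(Z″_n, (Z″_{n+1})^c) ≥ M·L^{n+1}·η (`LayerSep`), whence the (2.2)-form `SetSep` with threshold T = M/M₁ as soon as
L > 1 (M·Lⁿη < M·L^{n+1}η).  With M a multiple of M₁ (p. 177 (i); [15] p. 278) the threshold N = M/M₁ is an integer.

WHAT THIS FILE PROVES (kernel-checked, zero `sorry`; definitions WITH BODIES only — the hypothesis shapes `ZonesOfZ`,
`LayerSep`, `LayerSepZd`, the dart count `zoneCount` and the cube model `cube`/`corner`/`CubeSite`/`zoneC`/`posC`/`scaleC`/
`bondC`/`ZC`/`toR`; no new named fact, no `Prop` leaf; axioms standard).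
§1 (pure walk combinatorics in a zoned graph, NO connectedness — the sibling's `levelGap_dist` needs `G.Connected` because
   it speaks of `SimpleGraph.dist`): `zoneCount_ge` — under `LevelGap G zone N`, a walk from a point of zone < n to a point
   of zone > n has at least N darts STARTING in zone n (last exit from zone < n before the first entry into zone > n);
   `length_ge_mul_of_levelGap` — hence a walk from zone ≤ i to zone ≥ j + 1 has at least N·(j − i) bonds (the darts
   starting in the distinct zones i+1, …, j are distinct); `dist_ge_mul_of_levelGap` — the `SimpleGraph.dist` form under
   `Reachable`.
§2 (the p. 179 definition in printed metric shape ⇒ the walk form): `ZonesOfZ`, `LayerSep`; `setSep_of_layerSep` (one layer of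
   ML^{n+1}η-cubes between Z″_n and (Z″_{n+1})^c + L > 1 ⇒ (2.2)-form separation with T = M/M₁ for bonds of length M₁Lⁿη);
   `levelGap_of_layerSep`.
§3 (the B15 statement): `dist_ge_147` — for a `B6.Geometry` realised by a contour system (`Realizes`), y ∈ Γ″_i and y′ with
   ι y′ ∉ Z″_{j+1}, i ≤ j: (M/M₁)·(j − i) ≤ g.dist y y′ (given an admissible contour joining them — the print's *"the infimum
   is attained at some contour"*); `ineq147_geometry` — (1.47) itself, `B15.PrelimIntegrations.Ineq147 δ (g.dist y y′) M M₁ (j − i)`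
   for δ ≥ 0; `hD_147` — EXACTLY the hypothesis `hD` of r12's `B15Ineq148From190.ineq148_lattice_of_ineq190_gamma` with
   `dist := (M/M₁)(j − i)` (for which its `hgeo` is `le_rfl`), from the printed localisation *"the field … is localized in the
   domain Ω^c_{j+1}∖Z″_{j+1}"* (p. 186, (1.45)) read as: the block size of the field vanishes at sites of Z″_{j+1}.
§4 (a concrete ℤᵈ model, faithfulness/non-vacuity): sites = the M₁Lⁿ-cubes of ℤᵈ (η = 1 units) contained in Z″_{n+1}∖Z″_n,
   admissible bonds = pairs of cube-sites whose corners are within ℓ(min zone) in the sup-metric, positions = corners; from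
   `Monotone Z″` and the one-layer separation of the SETS Z″_n ⊂ ℤᵈ: `BondScale`, `SetSep`, `LevelGap (M/M₁)`, and the walk form
   of (1.47): every admissible contour from a zone-i cube to a cube outside Z″_{j+1} has at least (M/M₁)(j − i) bonds.
§5 (v1.1, reading-independent form): `DirectGap` (only DIRECT crossings of a zone are constrained and only the darts inside the
   zone are counted — weaker than `LevelGap`: `directGap_of_levelGap`), `separates_of_directGap`, `zoneCount_ge_of_directGap`,
   `length_ge_mul_of_directGap`, `dist_ge_mul_of_directGap`; `directGap_of_layerSep` — from the metric data under the
   NON-STRICT condition `(N − 1)·ℓ n + ℓ (n−1) < lay (n+1)` (the entering bond starts in zone `≤ n − 1` and is shorter);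
   `direct_threshold`/`directGap_Z` — satisfied by the B15 scales for bonds of length `M₁L^{n+e}η`, `e = 0` OR `e = 1`; hence
   `dist_ge_147'`, `ineq147_geometry'`, `hD_147'` — the (1.47) input, (1.47) and r12's `hD` under EITHER reading of
   *"M₁-cubes on corresponding scales"*.
§6 (v1.1): `LayerSepZdIn W` — the one-layer separation asked only against points of a region `W ⊇ ⋃_n Z″_n` (Bałaban's
   `Z″_n ⊂ Z`), `layerSep_cube_in`, `levelGap_cube_in`, `walk_length_ge_cube_in`.
HONEST SCOPE.  Nothing analytic; (1.45)/(1.46)/(1.48) untouched (rows B15.Eq1.45–1.48, r12/p29 files).  The reading of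
"admissible contour" and of the p. 179 separation sentence is the dictionary above (the same as `B6Geometry`'s); the bound is
proved for EVERY zoned graph with bonds of scale ℓ and the layer separation, so it holds in particular for Bałaban's.  READING
NOTE: *"M₁-cubes on corresponding scales"* is read as the scale `i` of `Γ″_i ⊂ T^{(i)}` (steps of length `M₁Lⁱη` in zone `i`);
then one separating layer (`ML^{i+1}η`) is `L·(M/M₁)` steps thick and the printed `(M/M₁)(j − i)` has a factor `L` to spare
(`threshold_lt_layer` uses only `L > 1`).  Under the coarser reading (steps `M₁L^{i+1}η` in zone `i`) the layer is exactly
`M/M₁` steps and the strict threshold inequality of [3] (2.2)/(2.57) degenerates to an equality; the printed bound still holds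
there (the bond ENTERING zone `i` is a finer one) though not by the `LevelGap` route of §§1–3 — §5 (v1.1) formalises exactly
this (`DirectGap`, `dist_ge_147'` with `e = 1`), so the (1.47) input is certified under BOTH readings.  The
existence of an admissible contour joining the two sites ([3] p. 231 *"the infimum is attained"*) is a hypothesis
(`Reachable`), as in `B6Geometry`.  NOT summit progress.
-/

namespace Literature.MathematicalPhysics.QuantumFieldTheory.Balaban1983to89.B15Ineq147LevelGap

open Literature.MathematicalPhysics.QuantumFieldTheory.Balaban1983to89
open B6Geometry B6LevelGapMetric
open Finset

/-! ## 1. Zoned graphs: darts per crossed zone, and the multi-level walk bound WITHOUT connectedness -/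

section Zoned

variable {V : Type*} {G : SimpleGraph V} {zone : V → ℕ}

/-- The number of darts (oriented bonds) of a walk whose FIRST vertex lies in zone `n` — the bonds of the contour that
*"consist of bonds of the lattice Λ_n"* counted from their starting point ([3] p. 231, (2.46)). [cite: Balaban1984PropagatorsII, (2.46) p.231] -/
def zoneCount (zone : V → ℕ) (n : ℕ) {u x : V} (p : G.Walk u x) : ℕ :=
  (p.darts.filter (fun d => zone d.fst = n)).length

omit zone in
/-- Filtering a longer list gives a list at least as long. [folklore] -/
private theorem length_filter_cons_le {α : Type*} (P : α → Bool) (a : α) (l : List α) :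
    (l.filter P).length ≤ ((a :: l).filter P).length := by
  rw [List.filter_cons]
  split <;> simp

/-- `zoneCount` of a one-bond extension only grows. [folklore] -/
private theorem zoneCount_le_cons (n : ℕ) {u v x : V} (h : G.Adj u v) (p : G.Walk v x) :
    zoneCount zone n p ≤ zoneCount zone n (SimpleGraph.Walk.cons h p) := by
  unfold zoneCount
  rw [SimpleGraph.Walk.darts_cons]
  exact length_filter_cons_le _ _ _

/-- `zoneCount` is additive under concatenation of contours. [folklore] -/
private theorem zoneCount_append (n : ℕ) {u v x : V} (p : G.Walk u v) (q : G.Walk v x) :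
    zoneCount zone n (p.append q) = zoneCount zone n p + zoneCount zone n q := by
  unfold zoneCount
  rw [SimpleGraph.Walk.darts_append, List.filter_append, List.length_append]

/-- If every dart of a walk starts in zone `n`, its `zoneCount n` is its length. [folklore] -/
private theorem zoneCount_eq_length_of_forall (n : ℕ) {u x : V} (p : G.Walk u x)
    (h : ∀ d ∈ p.darts, zone d.fst = n) : zoneCount zone n p = p.length := by
  unfold zoneCount
  rw [← SimpleGraph.Walk.length_darts, List.filter_eq_self.mpr]
  intro d hd
  simpa using h d hd

/-- The initial run of a contour inside one zone ([3] p. 231: *"Γ_{y_l,y′_l} does not intersect any other surface Σ_j"*):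
a walk starting in zone `n` and ending outside zone `n` splits as (a part all of whose darts start in zone `n`) followed by
(the rest), the junction being the first vertex outside zone `n`. [cite: Balaban1984PropagatorsII, (2.47) p.231] -/
theorem exists_initial_run (n : ℕ) :
    ∀ {a x : V} (q : G.Walk a x), zone a = n → zone x ≠ n →
      ∃ (b : V) (q₁ : G.Walk a b) (q₂ : G.Walk b x), q = q₁.append q₂ ∧ zone b ≠ n ∧
        ∀ d ∈ q₁.darts, zone d.fst = n := by
  intro a x q
  induction q with
  | nil => intro ha hx; exact absurd ha hx
  | @cons a b x h q ih =>
    intro ha hx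
    by_cases hb : zone b = n
    · obtain ⟨c, q₁, q₂, hq, hc, hd⟩ := ih hb hx
      refine ⟨c, SimpleGraph.Walk.cons h q₁, q₂, by rw [hq]; rfl, hc, ?_⟩
      intro d hd'
      rw [SimpleGraph.Walk.darts_cons, List.mem_cons] at hd'
      rcases hd' with rfl | hd'
      · exact ha
      · exact hd d hd'
    · refine ⟨b, SimpleGraph.Walk.cons h SimpleGraph.Walk.nil, q, rfl, hb, ?_⟩
      intro d hd'
      rw [SimpleGraph.Walk.darts_cons, SimpleGraph.Walk.darts_nil, List.mem_singleton] at hd'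
      subst hd'
      exact ha

/-- **Darts per crossed zone.**  Under the walk form `LevelGap G zone N` of [3] (2.2)/(2.57) (*a chain of admissible bonds
from a point of zone < n to a point of zone > n has more than N bonds*), every walk from a point of zone < n to a point of
zone > n has at least N darts STARTING IN ZONE n: take the last exit from the zones < n before the first entry into the
zones > n — between them the contour runs in zone n ([3] pp. 231–232, the portions Γ_{y′_l,y_{l+1}} ⊂ B^{j}(Λ_{j}) of
(2.47)–(2.48) with *"(L^{j_{l,l+1}}η)^{−1}|y′_l − y_{l+1}| > RM. (2.57)"*).  No connectedness is used. [cite: Balaban1984PropagatorsII, (2.47)–(2.48) pp.231–232; (2.57) p.233] -/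
theorem zoneCount_ge {N : ℕ} (hgap : LevelGap G zone N) (n : ℕ) :
    ∀ {v x : V} (p : G.Walk v x), zone v < n → n < zone x → N ≤ zoneCount zone n p := by
  rcases Nat.eq_zero_or_pos N with hN | hN
  · intro v x p _ _; rw [hN]; exact Nat.zero_le _
  have hsep : Separates G zone := separates_of_levelGap hgap (by omega)
  -- strong induction on the length of the walk
  suffices H : ∀ (ℓ : ℕ) {v x : V} (p : G.Walk v x), p.length ≤ ℓ → zone v < n → n < zone x →
      N ≤ zoneCount zone n p by
    intro v x p hv hx
    exact H p.length p le_rfl hv hx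
  intro ℓ
  induction ℓ with
  | zero =>
    intro v x p hp hv hx
    have h0 : p.length = 0 := Nat.le_zero.mp hp
    have := SimpleGraph.Walk.eq_of_length_eq_zero h0
    subst this
    omega
  | succ ℓ ih =>
    intro v x p hp hv hx
    cases p with
    | nil => omega
    | @cons _ v₁ _ h p' =>
      rw [SimpleGraph.Walk.length_cons] at hp
      have hp' : p'.length ≤ ℓ := by omega
      by_cases hv₁ : zone v₁ < n
      · exact (ih p' hp' hv₁ hx).trans (zoneCount_le_cons n h p')
      · -- the walk has entered zone n at v₁ (zones of neighbours differ by at most one)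
        have hz₁ : zone v₁ = n := by
          have := (hsep h).1
          omega
        obtain ⟨b, q₁, q₂, hq, hb, hd⟩ := exists_initial_run n p' hz₁ (by omega)
        have hcount : zoneCount zone n p' = zoneCount zone n q₁ + zoneCount zone n q₂ := by
          rw [hq, zoneCount_append]
        have hlen : p'.length = q₁.length + q₂.length := by
          rw [hq, SimpleGraph.Walk.length_append]
        rcases lt_or_gt_of_ne hb with hb' | hb'
        · -- the run returns below n: the rest `q₂` again goes from zone < n to zone > n, and is shorter
          have h₂ : N ≤ zoneCount zone n q₂ := ih q₂ (by omega) hb' hx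
          calc N ≤ zoneCount zone n q₂ := h₂
            _ ≤ zoneCount zone n p' := by omega
            _ ≤ zoneCount zone n (SimpleGraph.Walk.cons h p') := zoneCount_le_cons n h p'
        · -- the run exits above n: `v → v₁ → … → b` crosses from zone < n to zone > n, so it has > N bonds,
          -- all but the first starting in zone n
          have hcross : N + 1 ≤ (SimpleGraph.Walk.cons h q₁).length := hgap hv hb' _
          rw [SimpleGraph.Walk.length_cons] at hcross
          have hq₁ : zoneCount zone n q₁ = q₁.length := zoneCount_eq_length_of_forall n q₁ hd
          calc N ≤ q₁.length := by omega
            _ = zoneCount zone n q₁ := hq₁.symm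
            _ ≤ zoneCount zone n p' := by omega
            _ ≤ zoneCount zone n (SimpleGraph.Walk.cons h p') := zoneCount_le_cons n h p'

omit zone in
/-- Darts are counted at most once when sorted by the zone of their first vertex. [folklore] -/
private theorem sum_length_filter_le {α : Type*} (f : α → ℕ) (S : Finset ℕ) (l : List α) :
    ∑ n ∈ S, (l.filter (fun a => f a = n)).length ≤ l.length := by
  induction l with
  | nil => simp
  | cons a l ih =>
    have hstep : ∀ n ∈ S, ((a :: l).filter (fun a => f a = n)).length =
        (l.filter (fun a => f a = n)).length + (if f a = n then 1 else 0) := by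
      intro n _
      rw [List.filter_cons]
      by_cases h : f a = n
      · simp [h]
      · simp [h]
    rw [Finset.sum_congr rfl hstep, Finset.sum_add_distrib, List.length_cons]
    have h1 : ∑ n ∈ S, (if f a = n then 1 else 0) ≤ 1 := by
      rw [Finset.sum_ite_eq]
      split <;> simp
    omega

/-- The sum over distinct zones of the per-zone dart counts is at most the number of bonds. [folklore] -/
private theorem sum_zoneCount_le_length (S : Finset ℕ) {u x : V} (p : G.Walk u x) :
    ∑ n ∈ S, zoneCount zone n p ≤ p.length := by
  unfold zoneCount
  rw [← SimpleGraph.Walk.length_darts]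
  convert sum_length_filter_le (fun d : G.Dart => zone d.fst) S p.darts using 3

/-- **The multi-level walk bound** (the combinatorial content of [3] (2.47)–(2.48) + (2.57) ⇒ (2.60), in WALK form): under
`LevelGap G zone N`, every chain of admissible bonds from a point of zone ≤ i to a point of zone ≥ j + 1 has at least
N·(j − i) bonds (trivially so for j ≤ i) — it has ≥ N darts starting in each of the zones i+1, …, j (`zoneCount_ge`),
and these are distinct.  Unlike the sibling's `B6Geometry.levelGap_dist` (stated for `SimpleGraph.dist`, hence under
`G.Connected`) no connectedness is assumed. [cite: Balaban1984PropagatorsII, (2.47)–(2.48) pp.231–232; (2.57) p.233; (2.60) p.234] -/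
theorem length_ge_mul_of_levelGap {N : ℕ} (hgap : LevelGap G zone N) {i j : ℕ} {u x : V}
    (p : G.Walk u x) (hu : zone u ≤ i) (hx : j + 1 ≤ zone x) : N * (j - i) ≤ p.length := by
  have hcount : ∀ n ∈ Finset.Ioc i j, N ≤ zoneCount zone n p := by
    intro n hn
    rw [Finset.mem_Ioc] at hn
    exact zoneCount_ge hgap n p (by omega) (by omega)
  calc N * (j - i) = ∑ _n ∈ Finset.Ioc i j, N := by rw [Finset.sum_const, Nat.card_Ioc, smul_eq_mul, mul_comm]
    _ ≤ ∑ n ∈ Finset.Ioc i j, zoneCount zone n p := Finset.sum_le_sum hcount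
    _ ≤ p.length := sum_zoneCount_le_length _ p

/-- The same for the graph distance of two points joined by some admissible contour ([3] p. 231: *"Of course the infimum
is attained at some contour Γ_{y,y′}"*): N·(j − i) ≤ dist(u, x). [cite: Balaban1984PropagatorsII, (2.46) p.231; (2.60) p.234] -/
theorem dist_ge_mul_of_levelGap {N : ℕ} (hgap : LevelGap G zone N) {i j : ℕ} {u x : V}
    (hreach : G.Reachable u x) (hu : zone u ≤ i) (hx : j + 1 ≤ zone x) : N * (j - i) ≤ G.dist u x := by
  obtain ⟨p, hp⟩ := hreach.exists_walk_length_eq_dist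
  rw [← hp]
  exact length_ge_mul_of_levelGap hgap p hu hx

end Zoned

/-! ## 2. The p. 179 definition of the domains `Z″_n` in printed metric shape ⇒ the walk form `LevelGap (M/M₁)` -/

section Layers

variable {V : Type*} {X : Type*} [PseudoMetricSpace X] {Z : ℕ → Set V} {zone : V → ℕ} {pos : V → X}
  {ℓ lay : ℕ → ℝ} {T : ℝ}

/-- The zones of the admissible sequence `Ω″_n = (Z″_n)^c` of p. 179 ([3] (2.3)–(2.4) for that sequence): a lattice point
lies in `Z″_n` iff its zone is `< n` — so the points of `Γ″_n = (Z″_{n+1}∖Z″_n)^{(n)}` (p. 186) have zone `n` and the points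
of `(Z″_{j+1})^c ⊇ Ω^c_{j+1}∖Z″_{j+1}` have zone `≥ j + 1`. [cite: Balaban1989LargeFieldI, (1.10)–(1.12) p.179, (1.46) p.186; Balaban1984PropagatorsII, (2.3)–(2.4) p.224] -/
def ZonesOfZ (Z : ℕ → Set V) (zone : V → ℕ) : Prop :=
  ∀ x n, x ∈ Z n ↔ zone x < n

/-- The sets `Z″_n` increase with `n` (their complements *"form an admissible sequence of domains"*, p. 179). [cite: Balaban1989LargeFieldI, p.179] -/
theorem ZonesOfZ.monotone (hZ : ZonesOfZ Z zone) : Monotone Z := by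
  intro m n hmn x hx
  rw [hZ] at hx ⊢
  omega

/-- `ZonesOfZ` IS the sibling's `ZonesOf` for the complements `Ω″_n = (Z″_n)^c`. [cite: Balaban1989LargeFieldI, p.179; Balaban1984PropagatorsII, (2.3)–(2.4) p.224] -/
theorem ZonesOfZ.zonesOf_compl (hZ : ZonesOfZ Z zone) : ZonesOf (fun n => (Z n)ᶜ) zone := by
  intro x n
  rw [Set.mem_compl_iff, hZ, not_lt]

/-- A point of the layer `Z″_{n+1}∖Z″_n` (i.e. of `B^n(Γ″_n)`) has zone `n`. [cite: Balaban1989LargeFieldI, (1.46) p.186] -/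
theorem ZonesOfZ.zone_eq_of_mem_sdiff (hZ : ZonesOfZ Z zone) {x : V} {n : ℕ} (hx : x ∈ Z (n + 1) \ Z n) :
    zone x = n := by
  rcases hx with ⟨h1, h2⟩
  rw [hZ] at h1 h2
  omega

/-- A point outside `Z″_n` has zone `≥ n`; a point of `Z″_n` has zone `< n`. [cite: Balaban1989LargeFieldI, p.179] -/
theorem ZonesOfZ.le_zone_iff (hZ : ZonesOfZ Z zone) {x : V} {n : ℕ} : n ≤ zone x ↔ x ∉ Z n := by
  rw [hZ, not_lt]

/-- p. 179 *"Z″_k, Z″_{k−1} are separated by one layer of M-cubes … Z″_{k−1}, Z″_{k−2} are separated by one layer of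
L^{−1}M-cubes, and so on"*, metric form: a point of `Z″_n` and a point outside `Z″_{n+1}` are at least `lay (n+1)` apart
(`lay (n+1)` = the side `M·L^{n+1}·η` of the separating cubes). [cite: Balaban1989LargeFieldI, p.179] -/
def LayerSep (Z : ℕ → Set V) (pos : V → X) (lay : ℕ → ℝ) : Prop :=
  ∀ ⦃n : ℕ⦄ ⦃u x : V⦄, u ∈ Z n → x ∉ Z (n + 1) → lay (n + 1) ≤ dist (pos u) (pos x)

/-- The one-layer separation implies the sibling's set-level form of [3] (2.2) for `Ω″_n = (Z″_n)^c`, with any threshold `T`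
such that `T·ℓ n < lay (n+1)` (bond length `ℓ n` of zone `n`). [cite: Balaban1989LargeFieldI, p.179; Balaban1984PropagatorsII, (2.2) p.224] -/
theorem setSep_of_layerSep (hlay : LayerSep Z pos lay) (hT : ∀ n, T * ℓ n < lay (n + 1)) :
    SetSep (fun n => (Z n)ᶜ) pos ℓ T := by
  intro n u x hu hx
  have hu' : u ∈ Z n := by simpa using hu
  exact lt_of_lt_of_le (hT n) (hlay hu' hx)

/-- **The walk form of the separation.**  Zones of the `Z″`-sequence, bonds of scale `ℓ` (`BondScale`: a bond with an
end-point of zone `n` has length `≤ ℓ n`, `ℓ` monotone), one separating layer `lay (n+1) > T·ℓ n`, and `N ≤ T`: every chain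
of admissible bonds from a point of `Z″_n` to a point outside `Z″_{n+1}` has at least `N + 1` bonds
(`B6LevelGapMetric.levelGap_of_setSep`). [cite: Balaban1989LargeFieldI, p.179; Balaban1984PropagatorsII, (2.2) p.224 + (2.57) p.233] -/
theorem levelGap_of_layerSep {G : SimpleGraph V} {N : ℕ} (hZ : ZonesOfZ Z zone) (hmono : Monotone ℓ)
    (hlen : BondScale G zone pos ℓ) (hlay : LayerSep Z pos lay) (hT : ∀ n, T * ℓ n < lay (n + 1))
    (hNT : (N : ℝ) ≤ T) : LevelGap G zone N :=
  levelGap_of_setSep hZ.zonesOf_compl hmono hlen (setSep_of_layerSep hlay hT) hNT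

/-- The B15 scales: bonds of zone `n` are steps between `M₁Lⁿη`-cubes (*"the scaled distance … is defined in terms of
M₁-cubes on corresponding scales"*, p. 186), monotone in `n` for `L ≥ 1`. [cite: Balaban1989LargeFieldI, p.186] -/
theorem monotone_cubeScale {M₁ L η : ℝ} (hM₁ : 0 ≤ M₁) (hL : 1 ≤ L) (hη : 0 ≤ η) :
    Monotone (fun n : ℕ => M₁ * L ^ n * η) :=
  fun _ _ hab => mul_le_mul_of_nonneg_right (mul_le_mul_of_nonneg_left (pow_le_pow_right₀ hL hab) hM₁) hη

/-- The threshold arithmetic: `(M/M₁)·(M₁Lⁿη) = MLⁿη < ML^{n+1}η` for `M, M₁, η > 0`, `L > 1` — one layer of scale-`(n+1)`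
`M`-cubes is thicker than `M/M₁` cubes of scale `n` and side `M₁`. [cite: Balaban1989LargeFieldI, p.179, (1.47) p.186] -/
theorem threshold_lt_layer {M M₁ L η : ℝ} (hM : 0 < M) (hM₁ : 0 < M₁) (hL : 1 < L) (hη : 0 < η) (n : ℕ) :
    M / M₁ * (M₁ * L ^ n * η) < M * L ^ (n + 1) * η := by
  have h1 : M / M₁ * (M₁ * L ^ n * η) = M * L ^ n * η := by
    field_simp
  rw [h1, pow_succ]
  have hLn : 0 < L ^ n := pow_pos (by linarith) n
  nlinarith [mul_pos (mul_pos hM hLn) hη]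

/-- **`LevelGap (M/M₁)` for the `Z″`-sequence of p. 179** with the B15 scales: zones of the `Z″`-sequence, bonds of zone `n`
of length `≤ M₁Lⁿη`, one layer of `ML^{n+1}η`-cubes between `Z″_n` and `(Z″_{n+1})^c`, `L > 1`, and `N ≤ M/M₁`
(`N = M/M₁` when `M` is a multiple of `M₁`). [cite: Balaban1989LargeFieldI, p.179, (1.47) p.186; Balaban1984PropagatorsII, (2.2) p.224 + (2.57) p.233] -/
theorem levelGap_Z {G : SimpleGraph V} {M M₁ L η : ℝ} {N : ℕ} (hZ : ZonesOfZ Z zone)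
    (hlen : BondScale G zone pos (fun n => M₁ * L ^ n * η)) (hlay : LayerSep Z pos (fun n => M * L ^ n * η))
    (hM : 0 < M) (hM₁ : 0 < M₁) (hL : 1 < L) (hη : 0 < η) (hN : (N : ℝ) ≤ M / M₁) : LevelGap G zone N :=
  levelGap_of_layerSep hZ (monotone_cubeScale hM₁.le hL.le hη.le) hlen hlay (threshold_lt_layer hM hM₁ hL hη) hN

/-- **(1.47)'s distance input in WALK form** (no connectedness): with the data of `levelGap_Z` and `M = N·M₁` (`N = M/M₁ ∈ ℕ`),
every chain of admissible bonds from a point of zone `≤ i` (e.g. a point of `Γ″_i`) to a point outside `Z″_{j+1}` has at least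
`(M/M₁)·(j − i)` bonds. [cite: Balaban1989LargeFieldI, (1.47) p.186] -/
theorem walk_length_ge_Z {G : SimpleGraph V} {M M₁ L η : ℝ} {N : ℕ} (hZ : ZonesOfZ Z zone)
    (hlen : BondScale G zone pos (fun n => M₁ * L ^ n * η)) (hlay : LayerSep Z pos (fun n => M * L ^ n * η))
    (hM : 0 < M) (hM₁ : 0 < M₁) (hL : 1 < L) (hη : 0 < η) (hN : (N : ℝ) ≤ M / M₁)
    {i j : ℕ} {u x : V} (p : G.Walk u x) (hu : zone u ≤ i) (hx : x ∉ Z (j + 1)) : N * (j - i) ≤ p.length :=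
  length_ge_mul_of_levelGap (levelGap_Z hZ hlen hlay hM hM₁ hL hη hN) p hu (hZ.le_zone_iff.mpr hx)

end Layers

/-! ## 3. Over a `B6.Geometry` realised by a contour system: the distance input of (1.47), (1.47) itself, and r12's `hD` -/

section Geometry

variable {g : B6.Geometry} {C : ContourSystem g} {X : Type*} [PseudoMetricSpace X] {pos : C.Pt → X}
  {Z : ℕ → Set C.Pt}

/-- `(2.46)`-distance form of §1: for a geometry whose distance IS the number of admissible bonds of a shortest contour
(`Realizes g C`) and the walk form `LevelGap N`, two sites `y, y′` joined by some admissible contour with `scale y ≤ i` and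
`zone (ι y′) ≥ j + 1` satisfy `N·(j − i) ≤ d(y, y′)`. [cite: Balaban1984PropagatorsII, (2.46) p.231, (2.60) p.234] -/
theorem dist_ge_of_levelGap_realizes (h : Realizes g C) {N : ℕ} (hgap : LevelGap C.bond C.zone N) {i j : ℕ}
    {y y' : g.Site} (hreach : C.bond.Reachable (C.ι y) (C.ι y')) (hy : g.scale y ≤ i) (hy' : j + 1 ≤ C.zone (C.ι y')) :
    (N : ℝ) * ((j - i : ℕ) : ℝ) ≤ g.dist y y' := by
  have hz : C.zone (C.ι y) ≤ i := by rw [C.zone_ι y]; exact hy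
  have hd := dist_ge_mul_of_levelGap hgap hreach hz hy'
  rw [h y y', dist246]
  exact_mod_cast hd

/-- **The geometric input of (1.47)** (p. 186: *"by the definition of the domains Z″_i, we obtain … d(y, Ω^c_{j+1}∖Z″_{j+1})
≥ (M/M₁)(j − i) for y ∈ Γ″_i, i < j"*, in the form consumed by (1.45)–(1.48)): for a geometry realised by a contour system
whose zones are those of the `Z″`-sequence, whose admissible bonds of zone `n` have length `≤ M₁Lⁿη` (steps between
`M₁`-cubes of the corresponding scale) and whose sets `Z″_n ⊂ Z″_{n+1}` are separated by one layer of `ML^{n+1}η`-cubes, with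
`L > 1`, `η > 0` and `M` a positive multiple of `M₁`: every site `y` of scale `≤ i` (in particular `y ∈ Γ″_i`) and every site
`y′` outside `Z″_{j+1}` joined to it by an admissible contour satisfy `(M/M₁)(j − i) ≤ d(y, y′)`. [cite: Balaban1989LargeFieldI, (1.47) p.186, p.179; Balaban1984PropagatorsII, (2.46) p.231, (2.60) p.234] -/
theorem dist_ge_147 (h : Realizes g C) {M M₁ : ℕ} {L η : ℝ} (hZ : ZonesOfZ Z C.zone)
    (hlen : BondScale C.bond C.zone pos (fun n => (M₁ : ℝ) * L ^ n * η))
    (hlay : LayerSep Z pos (fun n => (M : ℝ) * L ^ n * η)) (hM : 0 < M) (hM₁ : 0 < M₁) (hdvd : M₁ ∣ M)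
    (hL : 1 < L) (hη : 0 < η) {i j : ℕ} {y y' : g.Site} (hreach : C.bond.Reachable (C.ι y) (C.ι y'))
    (hy : g.scale y ≤ i) (hy' : C.ι y' ∉ Z (j + 1)) :
    (M : ℝ) / M₁ * ((j - i : ℕ) : ℝ) ≤ g.dist y y' := by
  have hM' : (0 : ℝ) < M := by exact_mod_cast hM
  have hM₁' : (0 : ℝ) < M₁ := by exact_mod_cast hM₁
  have hcast : ((M / M₁ : ℕ) : ℝ) = (M : ℝ) / M₁ := Nat.cast_div hdvd hM₁'.ne'
  have hgap : LevelGap C.bond C.zone (M / M₁) :=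
    levelGap_Z hZ hlen hlay hM' hM₁' hL hη hcast.le
  have := dist_ge_of_levelGap_realizes h hgap hreach hy (hZ.le_zone_iff.mpr hy')
  rwa [hcast] at this

/-- **(1.47)** (p. 186): *"exp(−δd(y, Ω^c_{j+1}∖Z″_{j+1})) ≦ exp(−δ(M/M₁)(j − i)) for y ∈ Γ″_i, i < j. (1.47)"* — r12's typed
leaf `B15.PrelimIntegrations.Ineq147 δ d M M₁ (j − i)` for `d = d(y, y′)`, `y′` any site of the localisation domain (outside
`Z″_{j+1}`) joined to `y` by an admissible contour, `δ ≥ 0`, under the data of `dist_ge_147`; the monotonicity step is r12's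
`ineq147_of_dist`. [cite: Balaban1989LargeFieldI, (1.47) p.186] -/
theorem ineq147_geometry (h : Realizes g C) {M M₁ : ℕ} {L η : ℝ} (hZ : ZonesOfZ Z C.zone)
    (hlen : BondScale C.bond C.zone pos (fun n => (M₁ : ℝ) * L ^ n * η))
    (hlay : LayerSep Z pos (fun n => (M : ℝ) * L ^ n * η)) (hM : 0 < M) (hM₁ : 0 < M₁) (hdvd : M₁ ∣ M)
    (hL : 1 < L) (hη : 0 < η) {i j : ℕ} {y y' : g.Site} (hreach : C.bond.Reachable (C.ι y) (C.ι y'))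
    (hy : g.scale y ≤ i) (hy' : C.ι y' ∉ Z (j + 1)) {δ : ℝ} (hδ : 0 ≤ δ) :
    B15.PrelimIntegrations.Ineq147 δ (g.dist y y') M M₁ ((j - i : ℕ) : ℝ) :=
  B15.PrelimIntegrations.ineq147_of_dist
    (by nlinarith [dist_ge_147 h hZ hlen hlay hM hM₁ hdvd hL hη hreach hy hy', hδ])

/-- **The hypothesis `hD` of r12's `B15Ineq148From190.ineq148_lattice_of_ineq190_gamma` DISCHARGED** with
`dist := (M/M₁)(j − i)` (for which its `hgeo : i < j → (M/M₁)(j − i) ≤ dist` is `le_rfl`): if the field entering (1.45) is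
*"localized in the domain Ω^c_{j+1}∖Z″_{j+1}"* (p. 186) — read: its block size `loc y′` vanishes at every site of `Z″_{j+1}`,
`supp y′ → ι y′ ∉ Z″_{j+1}` for the support predicate `supp y′ := loc y′ B ≠ 0` — then `(M/M₁)(j − i) ≤ d(y, y′)` at every
site `y′` of its support (joined to `y` by an admissible contour), `y` of scale `≤ i`. [cite: Balaban1989LargeFieldI, (1.45)–(1.47) p.186] -/
theorem hD_147 (h : Realizes g C) {M M₁ : ℕ} {L η : ℝ} (hZ : ZonesOfZ Z C.zone)
    (hlen : BondScale C.bond C.zone pos (fun n => (M₁ : ℝ) * L ^ n * η))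
    (hlay : LayerSep Z pos (fun n => (M : ℝ) * L ^ n * η)) (hM : 0 < M) (hM₁ : 0 < M₁) (hdvd : M₁ ∣ M)
    (hL : 1 < L) (hη : 0 < η) {i j : ℕ} {y : g.Site} (hy : g.scale y ≤ i) {supp : g.Site → Prop}
    (hsupp : ∀ y', supp y' → C.ι y' ∉ Z (j + 1)) (hreach : ∀ y', supp y' → C.bond.Reachable (C.ι y) (C.ι y')) :
    ∀ y', supp y' → (M : ℝ) / M₁ * ((j - i : ℕ) : ℝ) ≤ g.dist y y' :=
  fun y' hs => dist_ge_147 h hZ hlen hlay hM hM₁ hdvd hL hη (hreach y' hs) hy (hsupp y' hs)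

end Geometry

/-! ## 4. A concrete `ℤᵈ` model: the `M₁Lⁿ`-cubes of the layers `Z″_{n+1}∖Z″_n` -/

section CubeModel

variable {d : ℕ}

/-- The lattice point `a ∈ ℤᵈ ≅ η⁻¹T_η` as a point of `ℝᵈ` (sup metric; η = 1 units), for the T_η-distances of [3] (2.2)/(2.48).
[cite: Balaban1984PropagatorsII, (2.2) p.224, (2.48) p.232] -/
def toR (a : Fin d → ℤ) : Fin d → ℝ := fun μ => (a μ : ℝ)

/-- The cube of side `M₁Lⁿ` and index `c` of the scale-`n` partition of `ℤᵈ` into `M₁`-cubes *"on corresponding scales"*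
(p. 186): `{x | M₁Lⁿ c_μ ≤ x_μ < M₁Lⁿ (c_μ + 1)}`. [cite: Balaban1989LargeFieldI, condition (i) p.177, p.186] -/
def cube (M₁ L n : ℕ) (c : Fin d → ℤ) : Set (Fin d → ℤ) :=
  {x | ∀ μ, ((M₁ * L ^ n : ℕ) : ℤ) * c μ ≤ x μ ∧ x μ < ((M₁ * L ^ n : ℕ) : ℤ) * (c μ + 1)}

/-- Its lowest corner `M₁Lⁿ·c` (a point of the cube, representing it in distance estimates). [cite: Balaban1989LargeFieldI, condition (i) p.177, p.186] -/
def corner (M₁ L n : ℕ) (c : Fin d → ℤ) : Fin d → ℤ := fun μ => ((M₁ * L ^ n : ℕ) : ℤ) * c μ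

/-- The corner is a point of the cube (side `≥ 1`). [cite: Balaban1989LargeFieldI, condition (i) p.177] -/
theorem corner_mem_cube {M₁ L n : ℕ} (hs : 0 < M₁ * L ^ n) (c : Fin d → ℤ) : corner M₁ L n c ∈ cube M₁ L n c := by
  intro μ
  refine ⟨le_rfl, ?_⟩
  simp only [corner]
  have : (0 : ℤ) < ((M₁ * L ^ n : ℕ) : ℤ) := by exact_mod_cast hs
  nlinarith

/-- The sites of the model: pairs `(n, c)` such that the scale-`n` cube `c` lies in the layer `Z″_{n+1}∖Z″_n` (= `B^n(Γ″_n)`,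
p. 186), for a family of sets `Z″_n ⊂ ℤᵈ`. [cite: Balaban1989LargeFieldI, p.179, (1.46) p.186] -/
def CubeSite (M₁ L : ℕ) (Z : ℕ → Set (Fin d → ℤ)) : Type :=
  {s : ℕ × (Fin d → ℤ) // cube M₁ L s.1 s.2 ⊆ Z (s.1 + 1) \ Z s.1}

variable {M₁ L : ℕ} {Z : ℕ → Set (Fin d → ℤ)}

/-- zone of a cube-site = its scale. [cite: Balaban1989LargeFieldI, (1.46) p.186] -/
def zoneC (s : CubeSite M₁ L Z) : ℕ := s.1.1

/-- position of a cube-site = its corner in `ℝᵈ` (the lattice point entering [3] (2.48)/(2.57)). [cite: Balaban1984PropagatorsII, (2.48) p.232, (2.57) p.233] -/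
def posC (s : CubeSite M₁ L Z) : Fin d → ℝ := toR (corner M₁ L s.1.1 s.1.2)

/-- the bond scale `M₁Lⁿ` (η = 1). [cite: Balaban1989LargeFieldI, p.186] -/
def scaleC (M₁ L n : ℕ) : ℝ := (M₁ : ℝ) * (L : ℝ) ^ n * 1

/-- The admissible bonds of the model: two distinct cube-sites whose corners are within one cube-step of the finer of the
two scales (sup metric) — every contour *"consisting of bonds of the lattice"* of `M₁`-cubes *"on corresponding scales"*
is a chain of such bonds. [cite: Balaban1989LargeFieldI, p.186; Balaban1984PropagatorsII, (2.46) p.231] -/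
def bondC (M₁ L : ℕ) (Z : ℕ → Set (Fin d → ℤ)) : SimpleGraph (CubeSite M₁ L Z) :=
  SimpleGraph.fromRel fun s t => dist (posC s) (posC t) ≤ scaleC M₁ L (min (zoneC s) (zoneC t))

/-- (len) holds in the model by construction. [cite: Balaban1984PropagatorsII, p.231] -/
theorem bondScale_cube : BondScale (bondC M₁ L Z) zoneC posC (scaleC M₁ L) := by
  intro s t h
  rw [bondC, SimpleGraph.fromRel_adj] at h
  rcases h.2 with h' | h'
  · exact h'
  · rwa [dist_comm, min_comm] at h'

/-- The model's `Z″_n` on sites: the cube-sites of scale `< n` (those lying in `Z″_n`). [cite: Balaban1989LargeFieldI, p.179] -/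
def ZC (M₁ L : ℕ) (Z : ℕ → Set (Fin d → ℤ)) : ℕ → Set (CubeSite M₁ L Z) := fun n => {s | zoneC s < n}

/-- … whose zones are the scales. [cite: Balaban1989LargeFieldI, p.179] -/
theorem zonesOfZ_cube : ZonesOfZ (ZC M₁ L Z) (zoneC (M₁ := M₁) (L := L) (Z := Z)) := fun _ _ => Iff.rfl

/-- The corner of a cube-site lies in the layer `Z″_{n+1}∖Z″_n` of its scale `n`. [cite: Balaban1989LargeFieldI, p.179] -/
theorem corner_mem_layer (hM₁ : 0 < M₁) (hL : 0 < L) (s : CubeSite M₁ L Z) :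
    corner M₁ L s.1.1 s.1.2 ∈ Z (s.1.1 + 1) \ Z s.1.1 :=
  s.2 (corner_mem_cube (Nat.mul_pos hM₁ (Nat.pow_pos hL)) _)

/-- One layer of `ML^{n+1}`-cubes between the SETS `Z″_n ⊂ ℤᵈ` and `(Z″_{n+1})^c` (p. 179), sup metric, η = 1:
`‖a − b‖_∞ ≥ M·L^{n+1}` for `a ∈ Z″_n`, `b ∉ Z″_{n+1}`. [cite: Balaban1989LargeFieldI, p.179] -/
def LayerSepZd (Z : ℕ → Set (Fin d → ℤ)) (M L : ℕ) : Prop :=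
  ∀ ⦃n : ℕ⦄ ⦃a b : Fin d → ℤ⦄, a ∈ Z n → b ∉ Z (n + 1) → (M : ℝ) * (L : ℝ) ^ (n + 1) ≤ dist (toR a) (toR b)

/-- The set-level separation of the nested `Z″_n ⊂ ℤᵈ` gives `LayerSep` for the cube-sites. [cite: Balaban1989LargeFieldI, p.179] -/
theorem layerSep_cube {M : ℕ} (hmono : Monotone Z) (hsep : LayerSepZd Z M L) (hM₁ : 0 < M₁) (hL : 0 < L) :
    LayerSep (ZC M₁ L Z) posC (fun n => (M : ℝ) * (L : ℝ) ^ n * 1) := by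
  intro n u x hu hx
  show (M : ℝ) * (L : ℝ) ^ (n + 1) * 1 ≤ _
  rw [mul_one]
  have hu' : corner M₁ L u.1.1 u.1.2 ∈ Z n :=
    hmono (show u.1.1 + 1 ≤ n from hu) (corner_mem_layer hM₁ hL u).1
  have hx' : corner M₁ L x.1.1 x.1.2 ∉ Z (n + 1) := fun hmem =>
    (corner_mem_layer hM₁ hL x).2 (hmono (show n + 1 ≤ x.1.1 from not_lt.mp hx) hmem)
  exact hsep hu' hx'

/-- **The walk form of (2.2) for the cube model**: nested `Z″_n ⊂ ℤᵈ` with one layer of `ML^{n+1}`-cubes between `Z″_n` and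
`(Z″_{n+1})^c`, `L ≥ 2`, `M₁ ≥ 1`, `M` a positive multiple of `M₁` ⇒ every chain of admissible bonds of cube-sites from scale
`< n` to scale `> n` has more than `M/M₁` bonds. [cite: Balaban1989LargeFieldI, p.179, (1.47) p.186; Balaban1984PropagatorsII, (2.57) p.233] -/
theorem levelGap_cube {M : ℕ} (hmono : Monotone Z) (hsep : LayerSepZd Z M L) (hM : 0 < M) (hM₁ : 0 < M₁)
    (hdvd : M₁ ∣ M) (hL : 2 ≤ L) : LevelGap (bondC M₁ L Z) zoneC (M / M₁) := by
  have hM' : (0 : ℝ) < M := by exact_mod_cast hM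
  have hM₁' : (0 : ℝ) < M₁ := by exact_mod_cast hM₁
  have hL' : (1 : ℝ) < L := by exact_mod_cast hL
  have hcast : ((M / M₁ : ℕ) : ℝ) = (M : ℝ) / M₁ := Nat.cast_div hdvd hM₁'.ne'
  exact levelGap_Z (η := 1) zonesOfZ_cube bondScale_cube (layerSep_cube hmono hsep hM₁ (by omega)) hM' hM₁' hL'
    one_pos hcast.le

/-- **(1.47)'s distance input in the cube model**: every chain of admissible bonds from a cube of scale `≤ i` (e.g. a cube of
`B^i(Γ″_i)`) to a cube NOT contained in `Z″_{j+1}` (e.g. a cube of the localisation domain `Ω^c_{j+1}∖Z″_{j+1}`) has at least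
`(M/M₁)·(j − i)` bonds — the scaled distance *"defined in terms of M₁-cubes on corresponding scales"* is `≥ (M/M₁)(j − i)`.
[cite: Balaban1989LargeFieldI, (1.47) p.186] -/
theorem walk_length_ge_cube {M : ℕ} (hmono : Monotone Z) (hsep : LayerSepZd Z M L) (hM : 0 < M) (hM₁ : 0 < M₁)
    (hdvd : M₁ ∣ M) (hL : 2 ≤ L) {i j : ℕ} {s t : CubeSite M₁ L Z} (p : (bondC M₁ L Z).Walk s t)
    (hs : zoneC s ≤ i) (ht : ¬ cube M₁ L t.1.1 t.1.2 ⊆ Z (j + 1)) : M / M₁ * (j - i) ≤ p.length := by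
  refine length_ge_mul_of_levelGap (levelGap_cube hmono hsep hM hM₁ hdvd hL) p hs ?_
  -- a cube not inside `Z″_{j+1}` has scale ≥ j + 1 (its layer `Z″_{n+1} ⊆ Z″_{j+1}` otherwise)
  by_contra hlt
  exact ht ((t.2.trans Set.sdiff_subset).trans (hmono (by unfold zoneC at hlt; omega)))

end CubeModel


/-! ## 5. (v1.1) Direct crossings: the reading-independent form of the (1.47) input

§§1–3 go through the walk form `LevelGap` of [3] (2.2)/(2.57), which needs a STRICT threshold `T·ℓ n < lay (n+1)`; under the
coarser reading of *"M₁-cubes on corresponding scales"* (steps of length `M₁L^{n+1}η` in zone `n`, the scale of the cubes the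
layer `Z″_{n+1}∖Z″_n` is made of) one separating layer `ML^{n+1}η` is EXACTLY `M/M₁` steps and the strict inequality fails.  The
printed bound survives because the bond ENTERING zone `n` starts in zone `n − 1` and is shorter.  This section proves the dart
count from that finer hypothesis (`DirectGap`: only DIRECT crossings are constrained, and only the darts inside zone `n` are
counted), derives it from the metric data under the non-strict condition `(N − 1)·ℓ n + ℓ (n−1) < lay (n+1)`, and concludes the
(1.47) input `(M/M₁)(j − i) ≤ d(y, y′)` for BOTH readings. -/

section Direct

variable {V : Type*} {G : SimpleGraph V} {zone : V → ℕ}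

/-- **Direct crossings.**  `DirectGap G zone N`: whenever a bond from a point `v` of zone `< n` is followed by a chain of
admissible bonds all of whose darts START in zone `n` and which ends at a point of zone `> n` (a direct crossing of the layer
of zone `n`, [3] p. 231: the portion *"Γ_{y′_l,y_{l+1}} … contained in B^{j_{l,l+1}}(Λ_{j_{l,l+1}})"* between two consecutive
surfaces), that chain has at least `N` bonds.  Weaker than `LevelGap G zone N` (`directGap_of_levelGap`).
[cite: Balaban1984PropagatorsII, (2.47)–(2.48) pp.231–232, (2.57) p.233] -/
def DirectGap (G : SimpleGraph V) (zone : V → ℕ) (N : ℕ) : Prop :=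
  ∀ ⦃n : ℕ⦄ ⦃v v₁ b : V⦄ (_h : G.Adj v v₁) (q : G.Walk v₁ b), zone v < n → n < zone b →
    (∀ d ∈ q.darts, zone d.fst = n) → N ≤ q.length

/-- `LevelGap N ⇒ DirectGap N` (the crossing `v → v₁ → … → b` has `> N` bonds, so the chain after `v` has `≥ N`).
[cite: Balaban1984PropagatorsII, (2.57) p.233] -/
theorem directGap_of_levelGap {N : ℕ} (hgap : LevelGap G zone N) : DirectGap G zone N := by
  intro n v v₁ b h q hv hb _
  have := hgap hv hb (SimpleGraph.Walk.cons h q)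
  rw [SimpleGraph.Walk.length_cons] at this
  omega

/-- Under `DirectGap N` with `N ≠ 0` the zones of adjacent points differ by at most one ([3] p. 231 *"The surface Σ_j separates
the sets B^j(Λ_j) and B^{j−1}(Λ_{j−1})"*). [cite: Balaban1984PropagatorsII, p.231] -/
theorem separates_of_directGap {N : ℕ} (hgap : DirectGap G zone N) (hN : N ≠ 0) : Separates G zone := by
  have key : ∀ ⦃u v : V⦄, G.Adj u v → zone v ≤ zone u + 1 := by
    intro u v h
    by_contra hlt
    have := hgap (n := zone u + 1) h (SimpleGraph.Walk.nil : G.Walk v v) (by omega) (by omega)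
      (by intro d hd; simp at hd)
    simp at this
    exact hN this
  intro u v h
  exact ⟨key h, key h.symm⟩

/-- **Darts per crossed zone from direct crossings**: `DirectGap N` already gives `≥ N` darts starting in zone `n` on every walk
from zone `< n` to zone `> n` (same induction as `zoneCount_ge`; the hypothesis is used exactly on the initial run in zone `n`).
[cite: Balaban1984PropagatorsII, (2.47)–(2.48) pp.231–232; (2.57) p.233] -/
theorem zoneCount_ge_of_directGap {N : ℕ} (hgap : DirectGap G zone N) (n : ℕ) :
    ∀ {v x : V} (p : G.Walk v x), zone v < n → n < zone x → N ≤ zoneCount zone n p := by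
  rcases Nat.eq_zero_or_pos N with hN | hN
  · intro v x p _ _; rw [hN]; exact Nat.zero_le _
  have hsep : Separates G zone := separates_of_directGap hgap (by omega)
  suffices H : ∀ (ℓ : ℕ) {v x : V} (p : G.Walk v x), p.length ≤ ℓ → zone v < n → n < zone x →
      N ≤ zoneCount zone n p by
    intro v x p hv hx
    exact H p.length p le_rfl hv hx
  intro ℓ
  induction ℓ with
  | zero =>
    intro v x p hp hv hx
    have h0 : p.length = 0 := Nat.le_zero.mp hp
    have := SimpleGraph.Walk.eq_of_length_eq_zero h0
    subst this
    omega
  | succ ℓ ih =>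
    intro v x p hp hv hx
    cases p with
    | nil => omega
    | @cons _ v₁ _ h p' =>
      rw [SimpleGraph.Walk.length_cons] at hp
      have hp' : p'.length ≤ ℓ := by omega
      by_cases hv₁ : zone v₁ < n
      · exact (ih p' hp' hv₁ hx).trans (zoneCount_le_cons n h p')
      · have hz₁ : zone v₁ = n := by
          have := (hsep h).1
          omega
        obtain ⟨b, q₁, q₂, hq, hb, hd⟩ := exists_initial_run n p' hz₁ (by omega)
        have hcount : zoneCount zone n p' = zoneCount zone n q₁ + zoneCount zone n q₂ := by
          rw [hq, zoneCount_append]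
        have hlen : p'.length = q₁.length + q₂.length := by
          rw [hq, SimpleGraph.Walk.length_append]
        rcases lt_or_gt_of_ne hb with hb' | hb'
        · have h₂ : N ≤ zoneCount zone n q₂ := ih q₂ (by omega) hb' hx
          calc N ≤ zoneCount zone n q₂ := h₂
            _ ≤ zoneCount zone n p' := by omega
            _ ≤ zoneCount zone n (SimpleGraph.Walk.cons h p') := zoneCount_le_cons n h p'
        · have hcross : N ≤ q₁.length := hgap h q₁ hv hb' hd
          have hq₁ : zoneCount zone n q₁ = q₁.length := zoneCount_eq_length_of_forall n q₁ hd
          calc N ≤ q₁.length := hcross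
            _ = zoneCount zone n q₁ := hq₁.symm
            _ ≤ zoneCount zone n p' := by omega
            _ ≤ zoneCount zone n (SimpleGraph.Walk.cons h p') := zoneCount_le_cons n h p'

/-- **The multi-level walk bound from direct crossings**: under `DirectGap N`, a chain of admissible bonds from zone `≤ i` to
zone `≥ j + 1` has at least `N·(j − i)` bonds. [cite: Balaban1984PropagatorsII, (2.47)–(2.48) pp.231–232; (2.60) p.234] -/
theorem length_ge_mul_of_directGap {N : ℕ} (hgap : DirectGap G zone N) {i j : ℕ} {u x : V}
    (p : G.Walk u x) (hu : zone u ≤ i) (hx : j + 1 ≤ zone x) : N * (j - i) ≤ p.length := by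
  have hcount : ∀ n ∈ Finset.Ioc i j, N ≤ zoneCount zone n p := by
    intro n hn
    rw [Finset.mem_Ioc] at hn
    exact zoneCount_ge_of_directGap hgap n p (by omega) (by omega)
  calc N * (j - i) = ∑ _n ∈ Finset.Ioc i j, N := by rw [Finset.sum_const, Nat.card_Ioc, smul_eq_mul, mul_comm]
    _ ≤ ∑ n ∈ Finset.Ioc i j, zoneCount zone n p := Finset.sum_le_sum hcount
    _ ≤ p.length := sum_zoneCount_le_length _ p

/-- … and for the graph distance of two points joined by an admissible contour. [cite: Balaban1984PropagatorsII, (2.46) p.231; (2.60) p.234] -/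
theorem dist_ge_mul_of_directGap {N : ℕ} (hgap : DirectGap G zone N) {i j : ℕ} {u x : V}
    (hreach : G.Reachable u x) (hu : zone u ≤ i) (hx : j + 1 ≤ zone x) : N * (j - i) ≤ G.dist u x := by
  obtain ⟨p, hp⟩ := hreach.exists_walk_length_eq_dist
  rw [← hp]
  exact length_ge_mul_of_directGap hgap p hu hx

variable {X : Type*} [PseudoMetricSpace X] {Z : ℕ → Set V} {pos : V → X} {ℓ lay : ℕ → ℝ}

/-- **Direct crossings from the metric data, NON-STRICT form.**  Zones of the `Z″`-sequence, bonds of scale `ℓ` (monotone,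
non-negative), one separating layer `lay (n+1)` between `Z″_n` and `(Z″_{n+1})^c`, and the condition
`(N − 1)·ℓ n + ℓ (n−1) < lay (n+1)` for `n ≥ 1` (the entering bond starts in zone `≤ n − 1`, the others in zone `n`): then
`DirectGap N` — by the triangle inequality along the crossing ([3] (2.48) *"|Γ_{y′_l,y_{l+1}}| ≥ |y′_l − y_{l+1}|"*).
[cite: Balaban1984PropagatorsII, (2.48) p.232, (2.57) p.233; Balaban1989LargeFieldI, p.179] -/
theorem directGap_of_layerSep {N : ℕ} (hZ : ZonesOfZ Z zone) (hmono : Monotone ℓ) (hℓ : ∀ n, 0 ≤ ℓ n)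
    (hlen : BondScale G zone pos ℓ) (hlay : LayerSep Z pos lay)
    (hN : ∀ n, 1 ≤ n → ((N : ℝ) - 1) * ℓ n + ℓ (n - 1) < lay (n + 1)) : DirectGap G zone N := by
  intro n v v₁ b h q hv hb hd
  have hn : 1 ≤ n := by omega
  have hvZ : v ∈ Z n := (hZ v n).mpr hv
  have hbZ : b ∉ Z (n + 1) := fun hmem => by have := (hZ b (n + 1)).mp hmem; omega
  have hsep := hlay hvZ hbZ
  -- the entering bond
  have h1 : dist (pos v) (pos v₁) ≤ ℓ (n - 1) :=
    (hlen h).trans (hmono ((min_le_left _ _).trans (by omega)))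
  -- the run in zone n
  have h2 : dist (pos v₁) (pos b) ≤ (q.length : ℝ) * ℓ n :=
    dist_le_length_mul pos (ℓ n) q fun d hd' =>
      (hlen d.adj).trans (hmono ((min_le_left _ _).trans (hd d hd').le))
  by_contra hlt
  push Not at hlt
  have hq : (q.length : ℝ) ≤ (N : ℝ) - 1 := by
    have : q.length + 1 ≤ N := hlt
    have : (q.length : ℝ) + 1 ≤ N := by exact_mod_cast this
    linarith
  have h3 : (q.length : ℝ) * ℓ n ≤ ((N : ℝ) - 1) * ℓ n := mul_le_mul_of_nonneg_right hq (hℓ n)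
  have := dist_triangle (pos v) (pos v₁) (pos b)
  linarith [hN n hn]

/-- The numeric condition for the B15 scales under BOTH readings of *"M₁-cubes on corresponding scales"*: with `ℓ n = M₁L^{n+e}η`
(`e = 0`: the scale of `Γ″_n ⊂ T^{(n)}`; `e = 1`: the scale of the `ML^{n+1}η`-cubes of the layer), `lay n = MLⁿη`, `N·M₁ = M`,
`L > 1`: `(N − 1)·ℓ n + ℓ (n−1) < ML^{n+1}η` for `n ≥ 1`. [cite: Balaban1989LargeFieldI, p.179, (1.47) p.186] -/
theorem direct_threshold {M M₁ L η : ℝ} {N : ℕ} {e : ℕ} (he : e ≤ 1) (hM₁ : 0 < M₁) (hL : 1 < L) (hη : 0 < η)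
    (hNM : (N : ℝ) * M₁ = M) {n : ℕ} (hn : 1 ≤ n) :
    ((N : ℝ) - 1) * (M₁ * L ^ (n + e) * η) + M₁ * L ^ (n - 1 + e) * η < M * L ^ (n + 1) * η := by
  -- L^{n-1+e} < L^{n+e} ≤ L^{n+1}
  have hlt : L ^ (n - 1 + e) < L ^ (n + e) := pow_lt_pow_right₀ hL (by omega)
  have hle : L ^ (n + e) ≤ L ^ (n + 1) := pow_le_pow_right₀ hL.le (by omega)
  have hM0 : 0 ≤ M := by rw [← hNM]; positivity
  -- (N-1)·M₁L^{n+e}η + M₁L^{n-1+e}η = M·L^{n+e}η − M₁η(L^{n+e} − L^{n-1+e}) < M·L^{n+e}η ≤ M·L^{n+1}η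
  have h1 : ((N : ℝ) - 1) * (M₁ * L ^ (n + e) * η) + M₁ * L ^ (n - 1 + e) * η =
      M * L ^ (n + e) * η - M₁ * η * (L ^ (n + e) - L ^ (n - 1 + e)) := by
    rw [← hNM]; ring
  have h2 : 0 < M₁ * η * (L ^ (n + e) - L ^ (n - 1 + e)) := mul_pos (mul_pos hM₁ hη) (by linarith)
  have h3 : M * L ^ (n + e) * η ≤ M * L ^ (n + 1) * η :=
    mul_le_mul_of_nonneg_right (mul_le_mul_of_nonneg_left hle hM0) hη.le
  rw [h1]
  linarith

/-- **`DirectGap (M/M₁)` for the `Z″`-sequence under either reading** (`e = 0` or `1`), `M = N·M₁`, `L > 1`, `η > 0`.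
[cite: Balaban1989LargeFieldI, p.179, (1.47) p.186; Balaban1984PropagatorsII, (2.57) p.233] -/
theorem directGap_Z {G : SimpleGraph V} {M M₁ L η : ℝ} {N e : ℕ} (he : e ≤ 1) (hZ : ZonesOfZ Z zone)
    (hlen : BondScale G zone pos (fun n => M₁ * L ^ (n + e) * η)) (hlay : LayerSep Z pos (fun n => M * L ^ n * η))
    (hM₁ : 0 < M₁) (hL : 1 < L) (hη : 0 < η) (hNM : (N : ℝ) * M₁ = M) : DirectGap G zone N := by
  refine directGap_of_layerSep hZ ?_ ?_ hlen hlay ?_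
  · exact fun a b hab => mul_le_mul_of_nonneg_right
      (mul_le_mul_of_nonneg_left (pow_le_pow_right₀ hL.le (by omega)) hM₁.le) hη.le
  · intro n; positivity
  · intro n hn
    exact direct_threshold he hM₁ hL hη hNM hn

end Direct

section GeometryDirect

variable {g : B6.Geometry} {C : ContourSystem g} {X : Type*} [PseudoMetricSpace X] {pos : C.Pt → X}
  {Z : ℕ → Set C.Pt}

/-- **The geometric input of (1.47), reading-independent form**: as `dist_ge_147`, but the admissible bonds of zone `n` may have
length up to `M₁L^{n+e}η` for `e = 0` (the scale of `Γ″_n`) OR `e = 1` (the scale of the cubes of the layer `Z″_{n+1}∖Z″_n`);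
`M = N·M₁` a positive multiple of `M₁`, `L > 1`, `η > 0`: `(M/M₁)(j − i) ≤ d(y, y′)` for `scale y ≤ i`, `ι y′ ∉ Z″_{j+1}`,
joined by an admissible contour. [cite: Balaban1989LargeFieldI, (1.47) p.186, p.179; Balaban1984PropagatorsII, (2.46)–(2.48) pp.231–232] -/
theorem dist_ge_147' (h : Realizes g C) {M M₁ : ℕ} {L η : ℝ} {e : ℕ} (he : e ≤ 1) (hZ : ZonesOfZ Z C.zone)
    (hlen : BondScale C.bond C.zone pos (fun n => (M₁ : ℝ) * L ^ (n + e) * η))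
    (hlay : LayerSep Z pos (fun n => (M : ℝ) * L ^ n * η)) (hM₁ : 0 < M₁) (hdvd : M₁ ∣ M)
    (hL : 1 < L) (hη : 0 < η) {i j : ℕ} {y y' : g.Site} (hreach : C.bond.Reachable (C.ι y) (C.ι y'))
    (hy : g.scale y ≤ i) (hy' : C.ι y' ∉ Z (j + 1)) :
    (M : ℝ) / M₁ * ((j - i : ℕ) : ℝ) ≤ g.dist y y' := by
  have hM₁' : (0 : ℝ) < M₁ := by exact_mod_cast hM₁
  have hcast : ((M / M₁ : ℕ) : ℝ) = (M : ℝ) / M₁ := Nat.cast_div hdvd hM₁'.ne'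
  have hNM : ((M / M₁ : ℕ) : ℝ) * M₁ = M := by rw [hcast]; field_simp
  have hgap : DirectGap C.bond C.zone (M / M₁) := directGap_Z he hZ hlen hlay hM₁' hL hη hNM
  have hz : C.zone (C.ι y) ≤ i := by rw [C.zone_ι y]; exact hy
  have hd := dist_ge_mul_of_directGap hgap hreach hz (hZ.le_zone_iff.mpr hy')
  rw [h y y', dist246, ← hcast]
  exact_mod_cast hd

/-- (1.47) under either reading (`ineq147_geometry` via `dist_ge_147'`). [cite: Balaban1989LargeFieldI, (1.47) p.186] -/
theorem ineq147_geometry' (h : Realizes g C) {M M₁ : ℕ} {L η : ℝ} {e : ℕ} (he : e ≤ 1) (hZ : ZonesOfZ Z C.zone)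
    (hlen : BondScale C.bond C.zone pos (fun n => (M₁ : ℝ) * L ^ (n + e) * η))
    (hlay : LayerSep Z pos (fun n => (M : ℝ) * L ^ n * η)) (hM₁ : 0 < M₁) (hdvd : M₁ ∣ M)
    (hL : 1 < L) (hη : 0 < η) {i j : ℕ} {y y' : g.Site} (hreach : C.bond.Reachable (C.ι y) (C.ι y'))
    (hy : g.scale y ≤ i) (hy' : C.ι y' ∉ Z (j + 1)) {δ : ℝ} (hδ : 0 ≤ δ) :
    B15.PrelimIntegrations.Ineq147 δ (g.dist y y') M M₁ ((j - i : ℕ) : ℝ) :=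
  B15.PrelimIntegrations.ineq147_of_dist
    (by nlinarith [dist_ge_147' h he hZ hlen hlay hM₁ hdvd hL hη hreach hy hy', hδ])

/-- r12's `hD` under either reading (`hD_147` via `dist_ge_147'`). [cite: Balaban1989LargeFieldI, (1.45)–(1.47) p.186] -/
theorem hD_147' (h : Realizes g C) {M M₁ : ℕ} {L η : ℝ} {e : ℕ} (he : e ≤ 1) (hZ : ZonesOfZ Z C.zone)
    (hlen : BondScale C.bond C.zone pos (fun n => (M₁ : ℝ) * L ^ (n + e) * η))
    (hlay : LayerSep Z pos (fun n => (M : ℝ) * L ^ n * η)) (hM₁ : 0 < M₁) (hdvd : M₁ ∣ M)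
    (hL : 1 < L) (hη : 0 < η) {i j : ℕ} {y : g.Site} (hy : g.scale y ≤ i) {supp : g.Site → Prop}
    (hsupp : ∀ y', supp y' → C.ι y' ∉ Z (j + 1)) (hreach : ∀ y', supp y' → C.bond.Reachable (C.ι y) (C.ι y')) :
    ∀ y', supp y' → (M : ℝ) / M₁ * ((j - i : ℕ) : ℝ) ≤ g.dist y y' :=
  fun y' hs => dist_ge_147' h he hZ hlen hlay hM₁ hdvd hL hη (hreach y' hs) hy (hsupp y' hs)

end GeometryDirect


/-! ## 6. (v1.1) The cube model with the separation asked only INSIDE the large field region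

`LayerSepZd` of §4 asks the one-layer separation against EVERY lattice point outside `Z″_{n+1}`; Bałaban's sets
`Z″_n ⊂ Z` (p. 179, (1.10)–(1.11)) are separated from `(Z″_{n+1})^c` only inside the region carrying the sites (all cube-sites
lie in `⋃_m Z″_m`).  The variant below asks the separation only against points of a set `W ⊇ ⋃_m Z″_m`. -/

section CubeModelIn

variable {d : ℕ} {M₁ L : ℕ} {Z : ℕ → Set (Fin d → ℤ)}

/-- One layer of `ML^{n+1}`-cubes between `Z″_n` and the points of `W` outside `Z″_{n+1}` (p. 179, read inside the region
`W`, e.g. `W = Z` or `W = ⋃_m Z″_m`). [cite: Balaban1989LargeFieldI, p.179, (1.12)] -/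
def LayerSepZdIn (W : Set (Fin d → ℤ)) (Z : ℕ → Set (Fin d → ℤ)) (M L : ℕ) : Prop :=
  ∀ ⦃n : ℕ⦄ ⦃a b : Fin d → ℤ⦄, a ∈ Z n → b ∈ W → b ∉ Z (n + 1) →
    (M : ℝ) * (L : ℝ) ^ (n + 1) ≤ dist (toR a) (toR b)

/-- The global form implies the local one. [cite: Balaban1989LargeFieldI, p.179] -/
theorem LayerSepZd.layerSepZdIn {M : ℕ} (h : LayerSepZd Z M L) (W : Set (Fin d → ℤ)) : LayerSepZdIn W Z M L :=
  fun _ _ _ ha _ hb => h ha hb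

/-- `LayerSep` for the cube-sites from the separation inside any `W` containing all the `Z″_n`. [cite: Balaban1989LargeFieldI, p.179] -/
theorem layerSep_cube_in {M : ℕ} {W : Set (Fin d → ℤ)} (hmono : Monotone Z) (hW : ∀ n, Z n ⊆ W)
    (hsep : LayerSepZdIn W Z M L) (hM₁ : 0 < M₁) (hL : 0 < L) :
    LayerSep (ZC M₁ L Z) posC (fun n => (M : ℝ) * (L : ℝ) ^ n * 1) := by
  intro n u x hu hx
  show (M : ℝ) * (L : ℝ) ^ (n + 1) * 1 ≤ _
  rw [mul_one]
  have hu' : corner M₁ L u.1.1 u.1.2 ∈ Z n :=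
    hmono (show u.1.1 + 1 ≤ n from hu) (corner_mem_layer hM₁ hL u).1
  have hxW : corner M₁ L x.1.1 x.1.2 ∈ W := hW _ (corner_mem_layer hM₁ hL x).1
  have hx' : corner M₁ L x.1.1 x.1.2 ∉ Z (n + 1) := fun hmem =>
    (corner_mem_layer hM₁ hL x).2 (hmono (show n + 1 ≤ x.1.1 from not_lt.mp hx) hmem)
  exact hsep hu' hxW hx'

/-- `LevelGap (M/M₁)` for the cube model from the separation inside `W ⊇ ⋃_n Z″_n`. [cite: Balaban1989LargeFieldI, p.179, (1.47) p.186] -/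
theorem levelGap_cube_in {M : ℕ} {W : Set (Fin d → ℤ)} (hmono : Monotone Z) (hW : ∀ n, Z n ⊆ W)
    (hsep : LayerSepZdIn W Z M L) (hM : 0 < M) (hM₁ : 0 < M₁) (hdvd : M₁ ∣ M) (hL : 2 ≤ L) :
    LevelGap (bondC M₁ L Z) zoneC (M / M₁) := by
  have hM' : (0 : ℝ) < M := by exact_mod_cast hM
  have hM₁' : (0 : ℝ) < M₁ := by exact_mod_cast hM₁
  have hL' : (1 : ℝ) < L := by exact_mod_cast hL
  have hcast : ((M / M₁ : ℕ) : ℝ) = (M : ℝ) / M₁ := Nat.cast_div hdvd hM₁'.ne'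
  exact levelGap_Z (η := 1) zonesOfZ_cube bondScale_cube (layerSep_cube_in hmono hW hsep hM₁ (by omega)) hM' hM₁' hL'
    one_pos hcast.le

/-- (1.47)'s input in the cube model, separation inside `W`: every chain of admissible bonds from a cube of scale `≤ i` to a
cube not contained in `Z″_{j+1}` has at least `(M/M₁)(j − i)` bonds. [cite: Balaban1989LargeFieldI, (1.47) p.186] -/
theorem walk_length_ge_cube_in {M : ℕ} {W : Set (Fin d → ℤ)} (hmono : Monotone Z) (hW : ∀ n, Z n ⊆ W)
    (hsep : LayerSepZdIn W Z M L) (hM : 0 < M) (hM₁ : 0 < M₁) (hdvd : M₁ ∣ M) (hL : 2 ≤ L) {i j : ℕ}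
    {s t : CubeSite M₁ L Z} (p : (bondC M₁ L Z).Walk s t) (hs : zoneC s ≤ i) (ht : ¬ cube M₁ L t.1.1 t.1.2 ⊆ Z (j + 1)) :
    M / M₁ * (j - i) ≤ p.length := by
  refine length_ge_mul_of_levelGap (levelGap_cube_in hmono hW hsep hM hM₁ hdvd hL) p hs ?_
  by_contra hlt
  exact ht ((t.2.trans Set.sdiff_subset).trans (hmono (by unfold zoneC at hlt; omega)))

end CubeModelIn

end Literature.MathematicalPhysics.QuantumFieldTheory.Balaban1983to89.B15Ineq147LevelGap
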